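import Summits.HodgeConjecture.HodgeConjecture.Theorems.F0P2oLocallyConstantCoboundary   -- ★ p829212 F0P2-p05 (g0): the GENERIC coboundary lemma `mem_span_mul_sub_of_apply_eq_zero`
import Literature.NumberTheory.GelbartRogawski1991.LocalUnitarySplittingDatum               -- ★ `adeleAddCharAt` (the character of `localSchrodinger`), `isLocallyConstant_of_isContinuousNontrivial`
import Literature.NumberTheory.Automorphic.QuadraticLocalNormCompatibility                   -- ★ `quadraticLocalEquiv`, `algebraNorm_quadraticLocalEquiv`, `toLocalRing_algebraNorm`
import Literature.NumberTheory.Automorphic.UnitaryGroupNonsplitPlace                         -- ★ `LocalRing.isField_of_smul_eq`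
import HarnessLib

/-!
# Crux `H413`, programme P2 — ROW «N3-S3»: KUDLA'S ANISOTROPY COBOUNDARY LEMMA AT A NON-SPLIT PLACE (the CM specialisation of ★ p829212):
# a Schwartz–Bruhat function on `E_v` vanishing at `0` is a sum of coboundaries `ψ_v(z·N y)·φ − φ`

Cell hodgecm-mathlib (D-0151), FLOOR 0, crux item H413 = stmt-HodgeConjecture-24833, route of record `HCCMUnconditional`; programme P2, road note
`F0/P2/B-p18/g28/N3-ROAD.v1.B-p18g28.md` §2 (S3) ∕ §4 (K1 lead B-p18 (g28)); desk F0P2-plan (g8) row «N3-S3», RESHAPED 17:06:50Z to the CM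
SPECIALISATION of F0P2-p05 (g0)'s generic ★ `F0P2oLocallyConstantCoboundary.mem_span_mul_sub_of_apply_eq_zero (𝒰) (h𝒰) (x₀) (hsep) (hf) (hf₀)`
(p829212).  HOME capital for the in-house road to the N3 letter (INVENTORY III-42) — count-neutral until an N3 line is registered.  LETTER-FREE,
THEOREMS ONLY (no definition, no named fact, no instance, no notation, no `sorry`); Lines-free.  HC_CM is proved only modulo the printed citations
until rung 0 closes; this file proves no letter.

THE THREE ★ CURRENCIES.  `E_v := UnitaryGroup.LocalRing L v = ∏_{w ∣ v} L_w` (`L` CM, `v` a finite place of `L⁺`), an `F_v := L⁺_v`-algebra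
(★ `QuadraticLocalBaseChange`); the norm `N := Algebra.norm F_v : E_v →* F_v` (Mathlib; `ι_v(N y) = y·ȳ` by ★ `toLocalRing_algebraNorm`); the local
additive character `ψ_v := adeleAddCharAt L⁺ v : AddChar F_v Circle` — THE character of the tree's local Schrödinger package ★ `localSchrodinger`
(hence of every `FinLocalSplittings.omegaLoc v`, `lineWeilCM`, `xThetaCM`), locally constant (★ `isLocallyConstant_of_isContinuousNontrivial` ∘
★ `isContinuousNontrivial_adeleAddCharAt`) and non-trivial (★ `exists_adeleAddCharAt_ne_one`).  The multipliers are
`𝒰_v := {y ↦ ψ_v(z · N y) | z ∈ F_v}` (read in `ℂ`).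

THE LEMMA [Kudla1986, proof of Thm. 2.8; GelbartRogawski1991 §3.2 (3.2.3) p. 457: `ω_ψ[(c,t)]Φ(w) = ψ(t N_{E∕F}(w)) ρ_ψ¹([cw,0]) Φ(w)`] at a place
`v` of `L⁺` NOT split in `L`: every `f ∈ 𝒮(E_v)` with `f 0 = 0` lies in the `ℂ`-span of the coboundaries `u·φ − φ` (`u ∈ 𝒰_v`, `φ ∈ 𝒮(E_v)`) —
§2 `mem_span_psiNorm_sub_of_apply_zero`; with the converse (every `u ∈ 𝒰_v` is `1` at `0`) the kernel form §2 `mem_span_psiNorm_sub_iff_apply_zero`: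
«the coinvariants of `𝒮(E_v)` under the centre characters `ψ_v(z·N(·))` are detected by `f ↦ f 0`» (and `f ↦ f 0` is onto `ℂ` by ★
`indicator_const_mem_schwartzBruhat` at any compact-open neighbourhood of `0`).  The two inputs of the generic lemma: LOCAL CONSTANCY of
`y ↦ ψ_v(z·N y)` (§1: `ψ_v` locally constant, `N` continuous — a polynomial in the coordinates of ★ `quadraticLocalEquiv`) and SEPARATION of `0`
(§1: at a non-split `v`, `E_v` is a FIELD — ★ `LocalRing.isField_of_smul_eq` — so `N` is ANISOTROPIC, `N y = 0 ↔ y = 0`; then `z := u·(N y)⁻¹` with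
`ψ_v u ≠ 1`).

## References
- [Kudla1986] S. Kudla, *On the local theta-correspondence*, Invent. Math. 83 (1986) 229–255 — Thm. 2.8 and its proof.
- [GelbartRogawski1991] S. Gelbart, J. Rogawski, *L-functions and Fourier–Jacobi coefficients for the unitary group U(3)*, Invent. Math. 105 (1991) — §3.2 (3.2.3) p. 457.
- [MoeglinVignerasWaldspurger1987] C. Mœglin, M.-F. Vignéras, J.-L. Waldspurger, *Correspondances de Howe sur un corps p-adique*, LNM 1291 — Ch. 2, I.2; Ch. 3, IV.5.
- [CasselsFrohlichANT1967] J. W. S. Cassels, A. Fröhlich (eds.), *Algebraic Number Theory* — Ch. II §§10–11; Ch. XV (Tate) Lemma 2.2.3.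
-/

set_option autoImplicit false
-- the mandated namespace has the single-problem summit's repeated segment (`HodgeConjecture.HodgeConjecture`)
set_option linter.dupNamespace false

noncomputable section

open Set Topology NumberField IsDedekindDomain

open Literature.NumberTheory.Automorphic Literature.NumberTheory.Automorphic.UnitaryGroup
open Literature.RepresentationTheory.HeisenbergGroup

namespace Summit.HodgeConjecture.HodgeConjecture.Cruxes.H413.F0P2oAnisotropicNormCoboundary

variable (L : Type) [Field L] [NumberField L] [IsCMField L] (v : HeightOneSpectrum (𝓞 ↥(maximalRealSubfield L)))

/-! ## §1 The multipliers `y ↦ ψ_v(z · N y)`: local constancy, value `1` at `0`, and separation of `0` at a non-split place -/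

/-- The norm `N_{E_v∕F_v} : E_v → F_v` is CONTINUOUS (a polynomial `a² − d b²` in the coordinates of ★ `quadraticLocalEquiv`; the ★ module
`QuadraticLocalNormCompatibility` proves this privately — restated here). [cite: CasselsFrohlichANT1967, Ch. II §11] -/
theorem continuous_algebraNorm_localRing :
    Continuous fun y : UnitaryGroup.LocalRing L v => Algebra.norm (v.adicCompletion ↥(maximalRealSubfield L)) y := by
  haveI := IsCMField.isQuadraticExtension L
  obtain ⟨σ, δ, hσδ, hδ⟩ := exists_algEquiv_apply_eq_neg (F := ↥(maximalRealSubfield L)) (E := L)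
  obtain ⟨d, hd⟩ := exists_mul_self_eq_algebraMap L σ hσδ hδ
  set Ψ := quadraticLocalEquiv L v σ hσδ hδ with hΨ
  have heq : (fun y : UnitaryGroup.LocalRing L v => Algebra.norm (v.adicCompletion ↥(maximalRealSubfield L)) y) =
      fun y => (Ψ.symm y).1 * (Ψ.symm y).1 - (d : v.adicCompletion ↥(maximalRealSubfield L)) * ((Ψ.symm y).2 * (Ψ.symm y).2) := by
    funext y
    conv_lhs => rw [← Ψ.apply_symm_apply y]
    rw [← algebraNorm_quadraticLocalEquiv L v σ hσδ hδ hd (Ψ.symm y).1 (Ψ.symm y).2]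
  rw [heq]
  have h1 : Continuous fun y : UnitaryGroup.LocalRing L v => (Ψ.symm y).1 := continuous_fst.comp Ψ.symm.continuous
  have h2 : Continuous fun y : UnitaryGroup.LocalRing L v => (Ψ.symm y).2 := continuous_snd.comp Ψ.symm.continuous
  exact (h1.mul h1).sub (continuous_const.mul (h2.mul h2))

/-- **LOCAL CONSTANCY**: `y ↦ ψ_v(z · N y)` is locally constant on `E_v` (`ψ_v` is locally constant on `F_v`, `y ↦ z · N y` is continuous).
[cite: MoeglinVignerasWaldspurger1987, Ch. 2 I.2] [cite: CasselsFrohlichANT1967, Ch. II §11] -/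
theorem isLocallyConstant_psi_mul_norm (z : v.adicCompletion ↥(maximalRealSubfield L)) :
    IsLocallyConstant fun y : UnitaryGroup.LocalRing L v =>
      ((adeleAddCharAt (↥(maximalRealSubfield L)) v (z * Algebra.norm (v.adicCompletion ↥(maximalRealSubfield L)) y) : Circle) : ℂ) :=
  (((isLocallyConstant_of_isContinuousNontrivial (isContinuousNontrivial_adeleAddCharAt (↥(maximalRealSubfield L)) v)).comp_continuous
    (continuous_const.mul (continuous_algebraNorm_localRing L v))).comp (fun c : Circle => (c : ℂ)) : _)

/-- **VALUE AT `0`**: `ψ_v(z · N 0) = 1` (`N 0 = 0`, `ψ_v 0 = 1`). [cite: MoeglinVignerasWaldspurger1987, Ch. 2 I.2] -/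
theorem psi_mul_norm_zero (z : v.adicCompletion ↥(maximalRealSubfield L)) :
    ((adeleAddCharAt (↥(maximalRealSubfield L)) v
      (z * Algebra.norm (v.adicCompletion ↥(maximalRealSubfield L)) (0 : UnitaryGroup.LocalRing L v)) : Circle) : ℂ) = 1 := by
  haveI := IsCMField.isQuadraticExtension L
  rw [Algebra.norm_zero, mul_zero, AddChar.map_zero_eq_one, Circle.coe_one]

/-- **ANISOTROPY at a non-split place**: if `v` does not split in `L`, `E_v = L_w` is a field (★ `LocalRing.isField_of_smul_eq`), so the norm form is
anisotropic: `N y = 0 → y = 0`. [cite: CasselsFrohlichANT1967, Ch. II §10] [cite: Kudla1986, proof of Thm. 2.8] -/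
theorem eq_zero_of_algebraNorm_eq_zero_of_nonsplit (hv : ∀ w : PlacesOver L v, IsCMField.complexConj L • w.1 = w.1)
    {y : UnitaryGroup.LocalRing L v} (hy : Algebra.norm (v.adicCompletion ↥(maximalRealSubfield L)) y = 0) : y = 0 := by
  haveI := IsCMField.isQuadraticExtension L
  obtain ⟨w⟩ : Nonempty (PlacesOver L v) := inferInstance
  have hF : IsField (UnitaryGroup.LocalRing L v) :=
    LocalRing.isField_of_smul_eq (IsCMField.complexConj L) (IsCMField.complexConj_ne_one L) w (hv w)
  letI : Field (UnitaryGroup.LocalRing L v) := hF.toField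
  exact Algebra.norm_eq_zero_iff.1 hy

/-- **SEPARATION OF `0`** at a non-split place: for `y ≠ 0` some multiplier is `≠ 1` at `y` — `N y ≠ 0` (anisotropy) and `ψ_v u ≠ 1` for some `u`
(★ `exists_adeleAddCharAt_ne_one`), so `z := u · (N y)⁻¹` works. [cite: Kudla1986, proof of Thm. 2.8] [cite: CasselsFrohlichANT1967, Ch. XV Lemma 2.2.3] -/
theorem exists_psi_mul_norm_ne_one (hv : ∀ w : PlacesOver L v, IsCMField.complexConj L • w.1 = w.1)
    {y : UnitaryGroup.LocalRing L v} (hy : y ≠ 0) :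
    ∃ z : v.adicCompletion ↥(maximalRealSubfield L),
      ((adeleAddCharAt (↥(maximalRealSubfield L)) v (z * Algebra.norm (v.adicCompletion ↥(maximalRealSubfield L)) y) : Circle) : ℂ) ≠ 1 := by
  have hN : Algebra.norm (v.adicCompletion ↥(maximalRealSubfield L)) y ≠ 0 :=
    fun h => hy (eq_zero_of_algebraNorm_eq_zero_of_nonsplit L v hv h)
  obtain ⟨u, hu⟩ := exists_adeleAddCharAt_ne_one (↥(maximalRealSubfield L)) v
  refine ⟨u * (Algebra.norm (v.adicCompletion ↥(maximalRealSubfield L)) y)⁻¹, ?_⟩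
  rw [inv_mul_cancel_right₀ hN, Ne, Circle.coe_eq_one]
  exact hu

/-! ## §2 The coboundary lemma at a non-split place (specialisation of ★ `F0P2oLocallyConstantCoboundary`) -/

/-- **KUDLA'S ANISOTROPY COBOUNDARY LEMMA AT A NON-SPLIT PLACE.**  At a place `v` of `L⁺` not split in `L`, every Schwartz–Bruhat `f` on
`E_v = ∏_{w∣v} L_w` with `f 0 = 0` lies in the `ℂ`-span of the coboundaries `ψ_v(z·N(·))·φ − φ` (`z ∈ F_v`, `φ ∈ 𝒮(E_v)`): «functions vanishing at
`y* = 0` are coboundaries for the centre of the Heisenberg parabolic» — the (S3) input of the N3 road, in the mixed model where the centre acts by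
`ψ(t N(w))` [GelbartRogawski1991 (3.2.3)].  Proof: ★ generic lemma (p829212) at `𝒰_v`, fed by §1.
[cite: Kudla1986, proof of Thm. 2.8] [cite: GelbartRogawski1991, §3.2 (3.2.3) p. 457] [cite: MoeglinVignerasWaldspurger1987, Ch. 3, IV.5] -/
theorem mem_span_psiNorm_sub_of_apply_zero (hv : ∀ w : PlacesOver L v, IsCMField.complexConj L • w.1 = w.1)
    {f : UnitaryGroup.LocalRing L v → ℂ} (hf : f ∈ SchwartzBruhat (UnitaryGroup.LocalRing L v)) (hf0 : f 0 = 0) :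
    f ∈ Submodule.span ℂ {g : UnitaryGroup.LocalRing L v → ℂ |
      ∃ u ∈ {u : UnitaryGroup.LocalRing L v → ℂ | ∃ z : v.adicCompletion ↥(maximalRealSubfield L), u = fun y =>
        ((adeleAddCharAt (↥(maximalRealSubfield L)) v (z * Algebra.norm (v.adicCompletion ↥(maximalRealSubfield L)) y) : Circle) : ℂ)},
      ∃ φ ∈ SchwartzBruhat (UnitaryGroup.LocalRing L v), g = u * φ - φ} := by
  refine F0P2oLocallyConstantCoboundary.mem_span_mul_sub_of_apply_eq_zero _ ?_ 0 ?_ hf hf0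
  · rintro u ⟨z, rfl⟩
    exact isLocallyConstant_psi_mul_norm L v z
  · intro y hy
    obtain ⟨z, hz⟩ := exists_psi_mul_norm_ne_one L v hv hy
    exact ⟨_, ⟨z, rfl⟩, hz⟩

/-- CONVERSE (generic over the multiplier set): if every multiplier is `1` at `x₀`, evaluation at `x₀` kills the span of the coboundaries `u·φ − φ`.
[cite: Kudla1986, proof of Thm. 2.8] -/
theorem apply_eq_zero_of_mem_span_mul_sub {X : Type*} [TopologicalSpace X] (𝒰 : Set (X → ℂ)) (x₀ : X) (h1 : ∀ u ∈ 𝒰, u x₀ = 1)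
    {f : X → ℂ} (hf : f ∈ Submodule.span ℂ {g : X → ℂ | ∃ u ∈ 𝒰, ∃ φ ∈ SchwartzBruhat X, g = u * φ - φ}) : f x₀ = 0 := by
  induction hf using Submodule.span_induction with
  | mem g hg =>
    obtain ⟨u, hu, φ, -, rfl⟩ := hg
    simp [h1 u hu]
  | zero => rfl
  | add g g' _ _ hg hg' => simp [hg, hg']
  | smul a g _ hg => simp [hg]

/-- **KERNEL FORM at a non-split place**: for `f ∈ 𝒮(E_v)`, `f` is a sum of coboundaries `ψ_v(z·N(·))·φ − φ` iff `f 0 = 0` — «the coinvariants of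
`𝒮(E_v)` under the centre characters are `ℂ`, via `f ↦ f 0`» (onto by ★ `F0P2oLocallyConstantCoboundary.indicator_const_mem_schwartzBruhat` at any
compact-open neighbourhood of `0`). [cite: Kudla1986, proof of Thm. 2.8] [cite: GelbartRogawski1991, §3.2 (3.2.3) p. 457] -/
theorem mem_span_psiNorm_sub_iff_apply_zero (hv : ∀ w : PlacesOver L v, IsCMField.complexConj L • w.1 = w.1)
    {f : UnitaryGroup.LocalRing L v → ℂ} (hf : f ∈ SchwartzBruhat (UnitaryGroup.LocalRing L v)) :
    f ∈ Submodule.span ℂ {g : UnitaryGroup.LocalRing L v → ℂ |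
      ∃ u ∈ {u : UnitaryGroup.LocalRing L v → ℂ | ∃ z : v.adicCompletion ↥(maximalRealSubfield L), u = fun y =>
        ((adeleAddCharAt (↥(maximalRealSubfield L)) v (z * Algebra.norm (v.adicCompletion ↥(maximalRealSubfield L)) y) : Circle) : ℂ)},
      ∃ φ ∈ SchwartzBruhat (UnitaryGroup.LocalRing L v), g = u * φ - φ} ↔ f 0 = 0 :=
  ⟨apply_eq_zero_of_mem_span_mul_sub _ 0 (by rintro u ⟨z, rfl⟩; exact psi_mul_norm_zero L v z),
    mem_span_psiNorm_sub_of_apply_zero L v hv hf⟩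

end Summit.HodgeConjecture.HodgeConjecture.Cruxes.H413.F0P2oAnisotropicNormCoboundary

end
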